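import Summits.CriticalPhenomena.Ising3DConformalLimit.Theorems.InverseSquareTelemetryInverseSquareLawTelemetricWindow
import Summits.CriticalPhenomena.Ising3DConformalLimit.Theorems.InverseSquareTelemetryInverseSquareLawTelemetricSoftBounds
import Summits.CriticalPhenomena.Ising3DConformalLimit.Theses.IsingEuclidUpgrade
import Literature.Probability.LatticeModels.IsingExponents
import Literature.Probability.LatticeModels.CorrelationDecayProofs
import HarnessLib

/-!
# Crux `InverseSquareLaw` (stmt-CriticalPhenomena-4495), line `registered` — the rate-free telemetric
# limit (stub S1) already gives the anomalous dimension `η`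

Route `InverseSquareTelemetry`, sub-problem `Ising3DConformalLimit`; THEOREM-ONLY file,
`--supports stmt-CriticalPhenomena-4495` (a consequence of the OPEN stub S1 `stub_telemetricLimit` of
the registered skeleton `Lines/birth.lean`; it is also a conditional reduction of item
stmt-CriticalPhenomena-0635 `IsingEuclidUpgradeR3EtaExists` to S1).

Write `G = criticalTwoPoint 3`, `s(x) = ∑ᵢ xᵢ² = |x|₂²`, `T(x) = s(x) · (Δ_{ℤ³}G)(x)/G(x)`.
**Theorem (`hasIsingExponentEta_of_telemetricLimit`, the route's "weak Agmon" for `G`).** If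
`T → κ` along the cofinite filter of `ℤ³` — NO rate — then `HasIsingExponentEta 3 η` with
`η = α₊(κ) - 1 = (√(1+4κ) - 1)/2` (`α₊` the decaying indicial root of `α(α-1) = κ`), i.e.
`log G(x) / log ‖x‖ → -(1+η)`; hence `∃ η ∈ [0, 1], HasIsingExponentEta 3 η`
(`exists_isingExponentEta_of_telemetricLimit`, using the window `κ ∈ [0, 2]` of
`telemetricLimit_mem_Icc`) and item 0635 follows from S1
(`isingEuclidUpgradeR3EtaExists_of_telemetricLimit`).

Proof: `κ ≥ 0` (`telemetricLimit_nonneg`); for `0 < δ ≤ 1/8` the limit supplies the soft bound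
`|s V_eff - κ| ≤ τ(κ,δ) = min(δ(√(1+4κ) - 2δ)/2, 1/8)` far out, so
`TelemetricSoftBounds.soft_powerBounds` (pure-power barriers `s^{-(α₊/2 ∓ δ)}`, weight `s^{-1/4}`,
`h`-transform comparison `sub_le_super_of_hTransform`, infrared bound `G ≤ C‖x‖⁻¹`) gives
`c_δ s^{-(α₊/2+δ)} ≤ G ≤ C_δ s^{-(α₊/2-δ)}` off the origin; letting `δ → 0` in
`log G / log ‖x‖` (`hasSpatialDecayExponent_of_soft_bounds`, `‖x‖² ≤ s ≤ 3‖x‖²`) yields the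
exponent. So within the line the Dini stub S3 is needed only for the SHARP law `G ≍ |x|^{-α₊}`
(`EtaBoundsFromTelemetry`) and the crux's rate, not for the existence of `η`. Method: Murata
(1986); Pinchover (1994); Keller–Pinchover–Pogorzelski, J. Spectral Theory 10 (2020) §4.2;
Friedli–Velenik (2017) §3.10.11 for the logarithmic exponent; all statements are elementary
consequences of tree theorems and tagged folklore.
-/

noncomputable section

namespace Summit.CriticalPhenomena.Ising3DConformalLimit.Theorems

open Literature.Probability.LatticeModels Finset Set Filter Topology
open Summit.CriticalPhenomena.Ising3DConformalLimit.Theorems.EtaBoundsFromTelemetry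
open Summit.CriticalPhenomena.Ising3DConformalLimit.Theorems.TelemetricWindow
open Summit.CriticalPhenomena.Ising3DConformalLimit.Theorems.TelemetricSoftBounds

namespace TelemetricLimitEta

/-- **Logarithmic decay exponent from soft two-sided power bounds.** If for every `0 < δ ≤ 1/8`
there are `c, C > 0` with `c s^{-(a/2+δ)} ≤ G ≤ C s^{-(a/2-δ)}` off the origin (`s = ∑ᵢ xᵢ²`,
`a ≥ 1`), then `log G(x) / log ‖x‖ → -a` along the cofinite filter of `ℤ³`
(`HasSpatialDecayExponent G a`; `‖x‖² ≤ s ≤ 3‖x‖²` exchanges `s` for the sup norm, and `δ → 0`).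
[folklore] -/
theorem hasSpatialDecayExponent_of_soft_bounds {G : Site 3 → ℝ} {a : ℝ} (ha : 1 ≤ a)
    (h : ∀ δ : ℝ, 0 < δ → δ ≤ 1 / 8 → ∃ c C : ℝ, 0 < c ∧ 0 < C ∧ ∀ x : Site 3, x ≠ 0 →
      c * (∑ i, ((x i : ℤ) : ℝ) ^ 2) ^ (-(a / 2 + δ)) ≤ G x ∧
      G x ≤ C * (∑ i, ((x i : ℤ) : ℝ) ^ 2) ^ (-(a / 2 - δ))) :
    HasSpatialDecayExponent G a := by
  unfold HasSpatialDecayExponent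
  have hlog : Tendsto (fun x : Site 3 => Real.log ‖x‖) cofinite atTop :=
    Real.tendsto_log_atTop.comp Site.tendsto_norm_cofinite_atTop
  have hev1 : ∀ᶠ x : Site 3 in cofinite, 1 < ‖x‖ :=
    Site.tendsto_norm_cofinite_atTop.eventually_gt_atTop 1
  -- norm exchange at a site with `1 < ‖x‖`
  have hnorm : ∀ x : Site 3, 1 < ‖x‖ → x ≠ 0 ∧ 0 < ‖x‖ ∧ 0 < Real.log ‖x‖ ∧
      0 < ‖x‖ ^ 2 ∧ ‖x‖ ^ 2 ≤ ∑ i, ((x i : ℤ) : ℝ) ^ 2 ∧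
      ∑ i, ((x i : ℤ) : ℝ) ^ 2 ≤ 3 * ‖x‖ ^ 2 := by
    intro x hx
    have hx0 : x ≠ 0 := by
      rintro rfl
      simp at hx
      linarith
    have hn : 0 < ‖x‖ := by linarith
    refine ⟨hx0, hn, Real.log_pos hx, by positivity, ?_, PerfectScreening.sum_sq_le_three_mul_norm_sq x⟩
    exact (Real.le_sqrt (norm_nonneg _) (by positivity)).1 (PerfectScreening.norm_le_sqrt_sum_sq x)
  refine tendsto_order.2 ⟨fun b hb => ?_, fun b hb => ?_⟩
  · -- lower estimate: `b < -a` is eventually exceeded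
    set δ : ℝ := min ((-a - b) / 8) (1 / 8) with hδ
    have hδ0 : 0 < δ := by rw [hδ]; exact lt_min (by linarith) (by norm_num)
    have hδ8 : δ ≤ 1 / 8 := min_le_right _ _
    have hδb : 8 * δ ≤ -a - b := by
      have : δ ≤ (-a - b) / 8 := min_le_left _ _
      linarith
    obtain ⟨c, C, hc, -, hbd⟩ := h δ hδ0 hδ8
    set c' : ℝ := c * (3 : ℝ) ^ (-(a / 2 + δ)) with hc'
    have hc'0 : 0 < c' := mul_pos hc (Real.rpow_pos_of_pos (by norm_num) _)
    have hK : Tendsto (fun x : Site 3 => Real.log c' / Real.log ‖x‖) cofinite (𝓝 0) :=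
      hlog.const_div_atTop (Real.log c')
    filter_upwards [hev1, hK.eventually (eventually_gt_nhds (show -δ < (0 : ℝ) by linarith))]
      with x hx hKx
    obtain ⟨hx0, hn, hlogx, hn2, hlow, hup⟩ := hnorm x hx
    obtain ⟨h1, -⟩ := hbd x hx0
    have he0 : -(a / 2 + δ) ≤ 0 := by linarith
    -- `G x ≥ c' ‖x‖^{-(a + 2δ)}`
    have hG : c' * ‖x‖ ^ (-(a + 2 * δ)) ≤ G x := by
      have h3 : (3 * ‖x‖ ^ 2) ^ (-(a / 2 + δ)) ≤ (∑ i, ((x i : ℤ) : ℝ) ^ 2) ^ (-(a / 2 + δ)) :=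
        Real.rpow_le_rpow_of_nonpos (by linarith) hup he0
      have hsplit : (3 * ‖x‖ ^ 2) ^ (-(a / 2 + δ)) = (3 : ℝ) ^ (-(a / 2 + δ)) * ‖x‖ ^ (-(a + 2 * δ)) := by
        rw [Real.mul_rpow (by norm_num) hn2.le, ← Real.rpow_two, ← Real.rpow_mul hn.le]
        congr 2; ring
      calc c' * ‖x‖ ^ (-(a + 2 * δ)) = c * (3 * ‖x‖ ^ 2) ^ (-(a / 2 + δ)) := by
            rw [hsplit, hc']; ring
        _ ≤ c * (∑ i, ((x i : ℤ) : ℝ) ^ 2) ^ (-(a / 2 + δ)) := mul_le_mul_of_nonneg_left h3 hc.le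
        _ ≤ G x := h1
    have hpow : 0 < ‖x‖ ^ (-(a + 2 * δ)) := Real.rpow_pos_of_pos hn _
    have hGpos : 0 < G x := (mul_pos hc'0 hpow).trans_le hG
    have hlogG : Real.log c' + (-(a + 2 * δ)) * Real.log ‖x‖ ≤ Real.log (G x) := by
      rw [← Real.log_rpow hn, ← Real.log_mul hc'0.ne' hpow.ne']
      exact Real.log_le_log (mul_pos hc'0 hpow) hG
    have hKx' : -δ * Real.log ‖x‖ < Real.log c' := (lt_div_iff₀ hlogx).1 hKx
    rw [lt_div_iff₀ hlogx]
    nlinarith [hlogG, hKx', hδb, hlogx]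
  · -- upper estimate: `b > -a` is eventually undershot
    set δ : ℝ := min ((b + a) / 8) (1 / 8) with hδ
    have hδ0 : 0 < δ := by rw [hδ]; exact lt_min (by linarith) (by norm_num)
    have hδ8 : δ ≤ 1 / 8 := min_le_right _ _
    have hδb : 8 * δ ≤ b + a := by
      have : δ ≤ (b + a) / 8 := min_le_left _ _
      linarith
    obtain ⟨c, C, hc, hC, hbd⟩ := h δ hδ0 hδ8
    have hK : Tendsto (fun x : Site 3 => Real.log C / Real.log ‖x‖) cofinite (𝓝 0) :=
      hlog.const_div_atTop (Real.log C)
    filter_upwards [hev1, hK.eventually (eventually_lt_nhds hδ0)] with x hx hKx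
    obtain ⟨hx0, hn, hlogx, hn2, hlow, hup⟩ := hnorm x hx
    obtain ⟨h1, h2⟩ := hbd x hx0
    have he0 : -(a / 2 - δ) ≤ 0 := by linarith
    -- `G x ≤ C ‖x‖^{-(a - 2δ)}` and `G x > 0`
    have hG : G x ≤ C * ‖x‖ ^ (-(a - 2 * δ)) := by
      have h3 : (∑ i, ((x i : ℤ) : ℝ) ^ 2) ^ (-(a / 2 - δ)) ≤ (‖x‖ ^ 2) ^ (-(a / 2 - δ)) :=
        Real.rpow_le_rpow_of_nonpos hn2 hlow he0
      have hsplit : (‖x‖ ^ 2) ^ (-(a / 2 - δ)) = ‖x‖ ^ (-(a - 2 * δ)) := by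
        rw [← Real.rpow_two, ← Real.rpow_mul hn.le]
        congr 1; ring
      calc G x ≤ C * (∑ i, ((x i : ℤ) : ℝ) ^ 2) ^ (-(a / 2 - δ)) := h2
        _ ≤ C * (‖x‖ ^ 2) ^ (-(a / 2 - δ)) := mul_le_mul_of_nonneg_left h3 hC.le
        _ = C * ‖x‖ ^ (-(a - 2 * δ)) := by rw [hsplit]
    have hGpos : 0 < G x := by
      have hS0 : (0 : ℝ) < ∑ i, ((x i : ℤ) : ℝ) ^ 2 := by linarith
      exact (mul_pos hc (Real.rpow_pos_of_pos hS0 _)).trans_le h1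
    have hpow : 0 < ‖x‖ ^ (-(a - 2 * δ)) := Real.rpow_pos_of_pos hn _
    have hlogG : Real.log (G x) ≤ Real.log C + (-(a - 2 * δ)) * Real.log ‖x‖ := by
      rw [← Real.log_rpow hn, ← Real.log_mul hC.ne' hpow.ne']
      exact Real.log_le_log hGpos hG
    have hKx' : Real.log C < δ * Real.log ‖x‖ := (div_lt_iff₀ hlogx).1 hKx
    rw [div_lt_iff₀ hlogx]
    nlinarith [hlogG, hKx', hδb, hlogx]

end TelemetricLimitEta

open TelemetricLimitEta

/-- **The rate-free telemetric limit gives the anomalous dimension (weak Agmon for `G`).** If the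
telemetry `T(x) = |x|₂² · (Δ_{ℤ³}G)(x)/G(x)` of `G = criticalTwoPoint 3` tends to `κ` along the
cofinite filter of `ℤ³` (stub S1 of crux `InverseSquareLaw`, NO rate), then the critical exponent
`η` of the `ℤ³` Ising model exists in the logarithmic sense, `HasIsingExponentEta 3 η` with
`η = α₊(κ) - 1 = (√(1+4κ) - 1)/2`, `α₊` the decaying indicial root of `α(α-1) = κ`. Proof:
`κ ≥ 0` (`telemetricLimit_nonneg`); for every `0 < δ ≤ 1/8` the limit supplies the soft telemetry
bound `|s·V_eff - κ| ≤ τ(κ, δ)` far out, whence `c_δ s^{-(α₊/2+δ)} ≤ G ≤ C_δ s^{-(α₊/2-δ)}` off the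
origin (`TelemetricSoftBounds.soft_powerBounds`: pure-power barriers, weight `s^{-1/4}`,
`h`-transform comparison, infrared bound `G ≤ C‖x‖⁻¹`); `δ → 0` gives
`log G / log ‖x‖ → -α₊` (`hasSpatialDecayExponent_of_soft_bounds`). The Dini rate (stub S3) is
thus needed only for the sharp constant, not for the existence of `η`. [folklore] -/
theorem hasIsingExponentEta_of_telemetricLimit {κ : ℝ}
    (hlim : Filter.Tendsto (fun x : Literature.Probability.LatticeModels.Site 3 => (∑ i, ((x i : ℝ)) ^ 2) * (((∑ i : Fin 3, (Literature.Probability.LatticeModels.criticalTwoPoint 3 (x + Pi.single i 1) + Literature.Probability.LatticeModels.criticalTwoPoint 3 (x - Pi.single i 1))) - 6 * Literature.Probability.LatticeModels.criticalTwoPoint 3 x) / Literature.Probability.LatticeModels.criticalTwoPoint 3 x)) Filter.cofinite (nhds κ)) :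
    HasIsingExponentEta 3 ((Real.sqrt (1 + 4 * κ) - 1) / 2) := by
  have hκ : 0 ≤ κ := telemetricLimit_nonneg hlim
  set r : ℝ := Real.sqrt (1 + 4 * κ) with hr
  have hr1 : 1 ≤ r := by
    simpa only [Real.sqrt_one] using Real.sqrt_le_sqrt (show (1 : ℝ) ≤ 1 + 4 * κ by linarith)
  unfold HasIsingExponentEta
  have e : ((3 : ℕ) : ℝ) - 2 + (r - 1) / 2 = (1 + r) / 2 := by push_cast; ring
  rw [e]
  refine hasSpatialDecayExponent_of_soft_bounds (a := (1 + r) / 2) (by linarith) fun δ hδ hδ8 => ?_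
  obtain ⟨C₁, hGup⟩ := criticalTwoPoint_le_rpow_neg_half
  -- the tolerance `τ(κ, δ)` and the soft telemetry bound far out
  set τ : ℝ := min (δ * (r - 2 * δ) / 2) (1 / 8) with hτ
  have hτ0 : 0 < τ := by
    have : 0 < r - 2 * δ := by linarith
    rw [hτ]
    exact lt_min (by positivity) (by norm_num)
  have hτ8 : τ ≤ 1 / 8 := min_le_right _ _
  have hτδ : τ ≤ δ * (Real.sqrt (1 + 4 * κ) - 2 * δ) / 2 := min_le_left _ _
  obtain ⟨V, hV⟩ : ∃ V : Site 3 → ℝ, ∀ x, V x =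
      latticeLaplacianZd (criticalTwoPoint 3) x / criticalTwoPoint 3 x := ⟨_, fun _ => rfl⟩
  have hsol : ∀ x : Site 3, x ≠ 0 →
      latticeLaplacianZd (criticalTwoPoint 3) x = V x * criticalTwoPoint 3 x := fun x hx => by
    rw [hV, div_mul_cancel₀ _ (criticalTwoPoint_pos' x hx).ne']
  have hT : ∀ᶠ x : Site 3 in cofinite, dist ((∑ i, ((x i : ℤ) : ℝ) ^ 2) *
      (((∑ i : Fin 3, (criticalTwoPoint 3 (x + Pi.single i 1) + criticalTwoPoint 3 (x - Pi.single i 1))) -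
        6 * criticalTwoPoint 3 x) / criticalTwoPoint 3 x)) κ < τ :=
    Metric.tendsto_nhds.1 hlim τ hτ0
  have hgood : ∀ᶠ x : Site 3 in cofinite, |(∑ i, ((x i : ℤ) : ℝ) ^ 2) * V x - κ| ≤ τ := by
    filter_upwards [hT] with x hTx
    rw [Real.dist_eq, telemetry_eq, ← hV] at hTx
    exact hTx.le
  obtain ⟨S, hS⟩ := exists_sumSq_threshold hgood
  obtain ⟨c, C', hc, hC', hbd⟩ :=
    soft_powerBounds hκ hδ hδ8 hτ8 hτδ criticalTwoPoint_pos' hGup hsol hS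
  refine ⟨c, C', hc, hC', fun x hx => ?_⟩
  have e1 : -((1 + r) / 2 / 2 + δ) = -((1 + Real.sqrt (1 + 4 * κ)) / 4 + δ) := by rw [hr]; ring
  have e2 : -((1 + r) / 2 / 2 - δ) = -((1 + Real.sqrt (1 + 4 * κ)) / 4 - δ) := by rw [hr]; ring
  rw [e1, e2]
  exact hbd x hx

/-- **Existence of `η` from the rate-free telemetric limit.** If the telemetry of the critical
two-point function of the `ℤ³` Ising model has a limit along the cofinite filter (the statement of
stub S1 `stub_telemetricLimit` of crux `InverseSquareLaw`, verbatim), then there is `η ∈ [0, 1]`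
with `HasIsingExponentEta 3 η` (`η = (√(1+4κ) - 1)/2`, `κ ∈ [0, 2]` by `telemetricLimit_mem_Icc`).
[folklore] -/
theorem exists_isingExponentEta_of_telemetricLimit
    (h : ∃ κ : ℝ, Filter.Tendsto (fun x : Literature.Probability.LatticeModels.Site 3 => (∑ i, ((x i : ℝ)) ^ 2) * (((∑ i : Fin 3, (Literature.Probability.LatticeModels.criticalTwoPoint 3 (x + Pi.single i 1) + Literature.Probability.LatticeModels.criticalTwoPoint 3 (x - Pi.single i 1))) - 6 * Literature.Probability.LatticeModels.criticalTwoPoint 3 x) / Literature.Probability.LatticeModels.criticalTwoPoint 3 x)) Filter.cofinite (nhds κ)) :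
    ∃ η : ℝ, 0 ≤ η ∧ η ≤ 1 ∧ HasIsingExponentEta 3 η := by
  obtain ⟨κ, hlim⟩ := h
  obtain ⟨hκ0, hκ2⟩ := telemetricLimit_mem_Icc hlim
  set r : ℝ := Real.sqrt (1 + 4 * κ) with hr
  have hr1 : 1 ≤ r := by
    simpa only [Real.sqrt_one] using Real.sqrt_le_sqrt (show (1 : ℝ) ≤ 1 + 4 * κ by linarith)
  have hr3 : r ≤ 3 := by
    have h9 : Real.sqrt 9 = 3 := by
      rw [show (9 : ℝ) = 3 ^ 2 by norm_num, Real.sqrt_sq (by norm_num : (0 : ℝ) ≤ 3)]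
    rw [hr, ← h9]
    exact Real.sqrt_le_sqrt (by linarith)
  exact ⟨(r - 1) / 2, by linarith, by linarith, hasIsingExponentEta_of_telemetricLimit hlim⟩

/-- **Stub S1 of crux `InverseSquareLaw` implies item stmt-CriticalPhenomena-0635** (crux r3
`IsingEuclidUpgradeR3EtaExists` of route `IsingEuclidUpgrade`: `∃ η, HasIsingExponentEta 3 η`): a
conditional reduction — the rate-free inverse-square law for `Δ_{ℤ³}G/G` already yields the existence
of the anomalous dimension in the logarithmic sense. [folklore] -/
theorem isingEuclidUpgradeR3EtaExists_of_telemetricLimit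
    (h : ∃ κ : ℝ, Filter.Tendsto (fun x : Literature.Probability.LatticeModels.Site 3 => (∑ i, ((x i : ℝ)) ^ 2) * (((∑ i : Fin 3, (Literature.Probability.LatticeModels.criticalTwoPoint 3 (x + Pi.single i 1) + Literature.Probability.LatticeModels.criticalTwoPoint 3 (x - Pi.single i 1))) - 6 * Literature.Probability.LatticeModels.criticalTwoPoint 3 x) / Literature.Probability.LatticeModels.criticalTwoPoint 3 x)) Filter.cofinite (nhds κ)) :
    Summit.CriticalPhenomena.Ising3DConformalLimit.Theses.IsingEuclidUpgrade.IsingEuclidUpgradeR3EtaExists := by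
  unfold Theses.IsingEuclidUpgrade.IsingEuclidUpgradeR3EtaExists
  obtain ⟨η, -, -, hη⟩ := exists_isingExponentEta_of_telemetricLimit h
  exact ⟨η, hη⟩

end Summit.CriticalPhenomena.Ising3DConformalLimit.Theorems
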